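import Mathlib
import HarnessLib

/-!
# Translation bookkeeping for region functionals on a finite abelian group (Ruelle's boundary estimate)

Topic `MathematicalPhysics/QuantumLattice` (model-free combinatorics behind the thermodynamic-limit
bookkeeping of translation-invariant finite-range interactions; written for the cell `hubbard-cq`, negation
lens N-W0-LOCAL / census (13), the site-local ε-lift barrier, file 3a). Sites form a finite additive
commutative group `G` (a discrete torus). A REGION FUNCTIONAL of the form

  `regionSum a k B = Σ_{x ∈ B} a x − Σ_{x ∈ B} Σ_{y ∈ B} k x y`

(`a x` = expectation of the on-site term at `x`, `k x y` = expectation of the two-site terms on the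
ordered pair `(x, y)`, in ONE fixed state) is what the expectation of the Hamiltonian restricted to the
region `B` looks like. Summing over all translates `B + v` of the region:

* `sum_regionSum_translateRegion` (exact identity):
  `Σ_v e(B + v) = |B| · e(G) + Σ_δ (|B| − N_B(δ)) · S(δ)`, `S(δ) = Σ_x k x (x + δ)`,
  `N_B(δ) = #{b ∈ B : b + δ ∈ B}` (`pairCount`) — single-site terms are counted `|B|` times each, a pair
  with separation `δ` is counted `N_B(δ)` times;
* `card_sub_pairCount_le_card_stepBoundary`: for a step `δ` of the range set `R`,
  `|B| − N_B(δ) ≤ |∂_R B|`, `∂_R B = {b ∈ B : ∃ δ ∈ R, b + δ ∉ B}` (`stepBoundary`);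
* `sum_regionSum_translateRegion_le` (Ruelle's boundary estimate): if `k x (x + δ) = 0` for `δ ∉ R` and
  `|k x (x + δ)| ≤ K δ` for `δ ∈ R`, then
  `Σ_v e(B + v) ≤ |B| · e(G) + |G| · |∂_R B| · Σ_{δ ∈ R} K δ`.

Dividing by `|G|` and using translation covariance of the Hamiltonian (`E₀(H_{B+v}) = E₀(H_B) ≤ e(B + v)` in
a ground state of the full Hamiltonian) this is `E₀(H_B) ≤ (|B|/|G|) E₀(H_G) + C |∂_R B|`
(`SourcedTorusRegionEnergyBound.lean`).

References: D. Ruelle, *Statistical Mechanics: Rigorous Results* (1969), §2.2–2.3 (boundary terms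
`|W| ≤ C |∂Λ|` of finite-range translation-invariant interactions) [cite: Ruelle1969, §2.3];
O. Bratteli, D. W. Robinson, *Operator Algebras and QSM II* (1997), §6.2.4 (surface energies)
[cite: BratteliRobinsonII1997, §6.2.4]. All statements are [folklore].

Tree search (`lean search 'translateRegion|pairCount|stepBoundary|regionSum'`): nothing; the tree's torus
tiling files (`HubbardNNNHoppingCut`, `FermionTorusBlockTiling`) count seams of RECTANGULAR cuts only.
-/

namespace Literature.MathematicalPhysics.QuantumLattice

open Finset

variable {G : Type*} [AddCommGroup G] [Fintype G] [DecidableEq G]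

/-! ### Translates, pair counts and the step boundary of a region -/

section Defs

/-- The translate `B + v = {b + v : b ∈ B}` of a region. [cite: Ruelle1969, §2.2] -/
def translateRegion (v : G) (B : Finset G) : Finset G := B.map (addRightEmbedding v)

/-- The pair count `N_B(δ) = #{b ∈ B : b + δ ∈ B}` (ordered pairs of `B` with separation `δ`).
[cite: Ruelle1969, §2.3] -/
def pairCount (B : Finset G) (δ : G) : ℕ := (B.filter fun b => b + δ ∈ B).card

/-- The inner `R`-boundary `∂_R B = {b ∈ B : ∃ δ ∈ R, b + δ ∉ B}` of a region w.r.t. a set of steps `R`.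
[cite: Ruelle1969, §2.3] -/
def stepBoundary (R : Finset G) (B : Finset G) : Finset G := B.filter fun b => ∃ δ ∈ R, b + δ ∉ B

/-- The region functional `e(B) = Σ_{x ∈ B} a x − Σ_{x ∈ B} Σ_{y ∈ B} k x y` (on-site expectations `a`,
ordered-pair expectations `k`, in one fixed state). [cite: Ruelle1969, §2.2] -/
def regionSum (a : G → ℝ) (k : G → G → ℝ) (B : Finset G) : ℝ := ∑ x ∈ B, a x - ∑ x ∈ B, ∑ y ∈ B, k x y

variable (v : G) (B R : Finset G) (δ : G)

omit [Fintype G] [DecidableEq G] in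
/-- Membership in a translate. [cite: Ruelle1969, §2.2] -/
theorem mem_translateRegion {x : G} : x ∈ translateRegion v B ↔ x - v ∈ B := by
  rw [translateRegion, Finset.mem_map]
  constructor
  · rintro ⟨b, hb, rfl⟩
    simpa using hb
  · intro h
    exact ⟨x - v, h, by simp⟩

omit [Fintype G] [DecidableEq G] in
/-- Translates have the same cardinality. [cite: Ruelle1969, §2.2] -/
@[simp] theorem card_translateRegion : (translateRegion v B).card = B.card := by
  rw [translateRegion, Finset.card_map]

omit [Fintype G] [DecidableEq G] in
/-- `B + 0 = B`. [cite: Ruelle1969, §2.2] -/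
@[simp] theorem translateRegion_zero : translateRegion (0 : G) B = B := by
  ext x; rw [mem_translateRegion, sub_zero]

omit [DecidableEq G] in
/-- The translate of the whole volume is the whole volume. [cite: Ruelle1969, §2.2] -/
@[simp] theorem translateRegion_univ : translateRegion v (Finset.univ : Finset G) = Finset.univ := by
  ext x; simp [mem_translateRegion]

/-- Translating the complement is the complement of the translate. [cite: Ruelle1969, §2.2] -/
theorem translateRegion_compl : translateRegion v Bᶜ = (translateRegion v B)ᶜ := by
  ext x; simp only [mem_translateRegion, Finset.mem_compl]

omit [Fintype G] [DecidableEq G] in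
/-- Sums over a translate. [cite: Ruelle1969, §2.2] -/
theorem sum_translateRegion {M : Type*} [AddCommMonoid M] (f : G → M) :
    ∑ x ∈ translateRegion v B, f x = ∑ b ∈ B, f (b + v) := by
  rw [translateRegion, Finset.sum_map]
  exact Finset.sum_congr rfl fun b _ => rfl

omit [Fintype G] in
/-- `N_B(δ) ≤ |B|`. [cite: Ruelle1969, §2.3] -/
theorem pairCount_le_card : pairCount B δ ≤ B.card := Finset.card_filter_le _ _

omit [Fintype G] in
/-- `N_B(0) = |B|`. [cite: Ruelle1969, §2.3] -/
@[simp] theorem pairCount_zero : pairCount B (0 : G) = B.card := by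
  unfold pairCount
  congr 1
  exact Finset.filter_true_of_mem fun b hb => by simpa using hb

omit [Fintype G] in
/-- `|B| − N_B(δ) = #{b ∈ B : b + δ ∉ B}`. [cite: Ruelle1969, §2.3] -/
theorem card_sub_pairCount_eq : B.card - pairCount B δ = (B.filter fun b => b + δ ∉ B).card := by
  have h := Finset.card_filter_add_card_filter_not (s := B) (fun b => b + δ ∈ B)
  unfold pairCount
  omega

omit [Fintype G] in
/-- **`|B| − N_B(δ) ≤ |∂_R B|` for a step `δ ∈ R`.** [cite: Ruelle1969, §2.3] -/
theorem card_sub_pairCount_le_card_stepBoundary {R : Finset G} {δ : G} (hδ : δ ∈ R) (B : Finset G) :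
    B.card - pairCount B δ ≤ (stepBoundary R B).card := by
  rw [card_sub_pairCount_eq]
  exact Finset.card_le_card (fun b hb => by
    rw [Finset.mem_filter] at hb
    exact Finset.mem_filter.2 ⟨hb.1, δ, hδ, hb.2⟩)

omit [Fintype G] in
/-- The step boundary lies in the region. [cite: Ruelle1969, §2.3] -/
theorem stepBoundary_subset : stepBoundary R B ⊆ B := Finset.filter_subset _ _

/-- The whole volume has no boundary. [cite: Ruelle1969, §2.3] -/
@[simp] theorem stepBoundary_univ : stepBoundary R (Finset.univ : Finset G) = ∅ := by
  unfold stepBoundary; simp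

omit [Fintype G] in
/-- The empty region has no boundary. [cite: Ruelle1969, §2.3] -/
@[simp] theorem stepBoundary_empty : stepBoundary R (∅ : Finset G) = ∅ := by
  unfold stepBoundary; simp

end Defs

/-! ### The translation-averaging identities -/

section Sums

variable (a : G → ℝ) (k : G → G → ℝ) (B : Finset G)

omit [DecidableEq G] in
/-- **Single-site terms**: `Σ_v Σ_{x ∈ B+v} a x = |B| · Σ_x a x`. [cite: Ruelle1969, §2.3] -/
theorem sum_sum_translateRegion_eq : ∑ v, ∑ x ∈ translateRegion v B, a x = B.card * ∑ x, a x := by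
  simp_rw [sum_translateRegion]
  rw [Finset.sum_comm]
  have h : ∀ b ∈ B, ∑ v, a (b + v) = ∑ x, a x := fun b _ =>
    Fintype.sum_equiv (Equiv.addLeft b) _ _ fun v => rfl
  rw [Finset.sum_congr rfl h, Finset.sum_const, nsmul_eq_mul]

omit [DecidableEq G] in
/-- **Pair terms**: `Σ_v Σ_{x,y ∈ B+v} k x y = Σ_{b,b' ∈ B} Σ_x k x (x + (b' − b))`. [cite: Ruelle1969, §2.3] -/
theorem sum_sum_sum_translateRegion_eq :
    ∑ v, ∑ x ∈ translateRegion v B, ∑ y ∈ translateRegion v B, k x y =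
      ∑ b ∈ B, ∑ b' ∈ B, ∑ x, k x (x + (b' - b)) := by
  simp_rw [sum_translateRegion]
  rw [Finset.sum_comm]
  refine Finset.sum_congr rfl fun b _ => ?_
  rw [Finset.sum_comm]
  refine Finset.sum_congr rfl fun b' _ => ?_
  refine Fintype.sum_equiv (Equiv.addLeft b) _ _ fun v => ?_
  simp only [Equiv.coe_addLeft]
  congr 1
  abel

/-- **Fibrewise count**: `Σ_{b,b' ∈ B} S(b' − b) = Σ_δ N_B(δ) · S δ`. [cite: Ruelle1969, §2.3] -/
theorem sum_sum_sub_eq_sum_pairCount_mul (S : G → ℝ) :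
    ∑ b ∈ B, ∑ b' ∈ B, S (b' - b) = ∑ δ, (pairCount B δ : ℝ) * S δ := by
  -- rewrite the inner sum over `b'` as a sum over the separation `δ = b' - b`
  have h1 : ∀ b ∈ B, ∑ b' ∈ B, S (b' - b) = ∑ δ, (if b + δ ∈ B then S δ else 0) := by
    intro b _
    have h2 : ∑ b' ∈ B, S (b' - b) = ∑ b', (if b' ∈ B then S (b' - b) else 0) := by
      rw [← Finset.sum_filter]
      congr 1
      ext x
      simp
    rw [h2]
    exact (Fintype.sum_equiv (Equiv.addLeft b) (fun δ => if b + δ ∈ B then S δ else 0)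
      (fun b' => if b' ∈ B then S (b' - b) else 0) fun δ => by simp).symm
  rw [Finset.sum_congr rfl h1, Finset.sum_comm]
  refine Finset.sum_congr rfl fun δ _ => ?_
  rw [Finset.sum_ite, Finset.sum_const_zero, add_zero, Finset.sum_const, nsmul_eq_mul, pairCount]

omit [DecidableEq G] in
/-- Reindexing the double sum over all pairs by the separation: `Σ_x Σ_y k x y = Σ_δ Σ_x k x (x + δ)`.
[cite: Ruelle1969, §2.3] -/
theorem sum_sum_eq_sum_sum_add : ∑ x, ∑ y, k x y = ∑ δ, ∑ x, k x (x + δ) := by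
  calc ∑ x, ∑ y, k x y = ∑ x, ∑ δ, k x (x + δ) := Finset.sum_congr rfl fun x _ =>
        (Fintype.sum_equiv (Equiv.addLeft x) (fun δ => k x (x + δ)) (fun y => k x y) fun δ => rfl).symm
    _ = ∑ δ, ∑ x, k x (x + δ) := Finset.sum_comm

/-- **The translation-averaging identity**:
`Σ_v e(B + v) = |B| · e(G) + Σ_δ (|B| − N_B(δ)) Σ_x k x (x + δ)`. [cite: Ruelle1969, §2.3] -/
theorem sum_regionSum_translateRegion :
    ∑ v, regionSum a k (translateRegion v B) =
      B.card * regionSum a k Finset.univ +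
        ∑ δ, ((B.card : ℝ) - pairCount B δ) * ∑ x, k x (x + δ) := by
  unfold regionSum
  rw [Finset.sum_sub_distrib, sum_sum_translateRegion_eq, sum_sum_sum_translateRegion_eq,
    sum_sum_sub_eq_sum_pairCount_mul B (fun δ => ∑ x, k x (x + δ)), sum_sum_eq_sum_sum_add]
  simp only [sub_mul, Finset.sum_sub_distrib, ← Finset.mul_sum]
  ring

end Sums

/-! ### Ruelle's boundary estimate -/

section Bound

variable (a : G → ℝ) (k : G → G → ℝ) (B R : Finset G) (K : G → ℝ)

omit [DecidableEq G] in
/-- `|Σ_x k x (x + δ)| ≤ |G| · K δ` under a uniform bound. [cite: Ruelle1969, §2.3] -/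
theorem abs_sum_pair_le {k : G → G → ℝ} {K : G → ℝ} {δ : G} (hK : ∀ x, |k x (x + δ)| ≤ K δ) :
    |∑ x, k x (x + δ)| ≤ Fintype.card G * K δ := by
  calc |∑ x, k x (x + δ)| ≤ ∑ x, |k x (x + δ)| := Finset.abs_sum_le_sum_abs _ _
    _ ≤ ∑ _x : G, K δ := Finset.sum_le_sum fun x _ => hK x
    _ = Fintype.card G * K δ := by rw [Finset.sum_const, Finset.card_univ, nsmul_eq_mul]

/-- **Ruelle's boundary estimate for the translation average.** If the pair expectations vanish beyond
the range set `R` (`k x (x + δ) = 0` for `δ ∉ R`) and are uniformly bounded on it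
(`|k x (x + δ)| ≤ K δ` for `δ ∈ R`), then
`Σ_v e(B + v) ≤ |B| · e(G) + |G| · |∂_R B| · Σ_{δ ∈ R} K δ`. [cite: Ruelle1969, §2.3] -/
theorem sum_regionSum_translateRegion_le (hk0 : ∀ δ, δ ∉ R → ∀ x, k x (x + δ) = 0)
    (hK : ∀ δ ∈ R, ∀ x, |k x (x + δ)| ≤ K δ) :
    ∑ v, regionSum a k (translateRegion v B) ≤
      B.card * regionSum a k Finset.univ +
        Fintype.card G * (stepBoundary R B).card * ∑ δ ∈ R, K δ := by
  rw [sum_regionSum_translateRegion]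
  suffices herr : ∑ δ, ((B.card : ℝ) - pairCount B δ) * ∑ x, k x (x + δ) ≤
      Fintype.card G * (stepBoundary R B).card * ∑ δ ∈ R, K δ by linarith
  -- restrict the error sum to `R`
  have hsplit : ∑ δ, ((B.card : ℝ) - pairCount B δ) * ∑ x, k x (x + δ) =
      ∑ δ ∈ R, ((B.card : ℝ) - pairCount B δ) * ∑ x, k x (x + δ) := by
    rw [← Finset.sum_subset (Finset.subset_univ R)]
    intro δ _ hδ
    rw [Finset.sum_congr rfl fun x _ => hk0 δ hδ x, Finset.sum_const_zero, mul_zero]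
  rw [hsplit, Finset.mul_sum]
  refine Finset.sum_le_sum fun δ hδ => ?_
  have h1 : (0 : ℝ) ≤ (B.card : ℝ) - pairCount B δ := by
    have := pairCount_le_card B δ
    exact sub_nonneg.2 (by exact_mod_cast this)
  have h2 : (B.card : ℝ) - pairCount B δ ≤ (stepBoundary R B).card := by
    have h := card_sub_pairCount_le_card_stepBoundary hδ B
    have h' := pairCount_le_card B δ
    have : ((B.card - pairCount B δ : ℕ) : ℝ) = (B.card : ℝ) - pairCount B δ := by
      rw [Nat.cast_sub h']
    rw [← this]
    exact_mod_cast h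
  have h3 : ∑ x, k x (x + δ) ≤ Fintype.card G * K δ := (le_abs_self _).trans (abs_sum_pair_le (hK δ hδ))
  have hKδ : 0 ≤ K δ := by
    obtain ⟨x⟩ : Nonempty G := ⟨0⟩
    exact (abs_nonneg _).trans (hK δ hδ x)
  calc ((B.card : ℝ) - pairCount B δ) * ∑ x, k x (x + δ)
      ≤ ((B.card : ℝ) - pairCount B δ) * (Fintype.card G * K δ) := mul_le_mul_of_nonneg_left h3 h1
    _ ≤ (stepBoundary R B).card * (Fintype.card G * K δ) :=
        mul_le_mul_of_nonneg_right h2 (mul_nonneg (Nat.cast_nonneg _) hKδ)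
    _ = Fintype.card G * (stepBoundary R B).card * K δ := by ring

/-- **Averaged form**: with `N = |G|` and a lower bound `E ≤ e(B + v)` valid for every translate (e.g.
`E = E₀(H_B) = E₀(H_{B+v})` by translation covariance, in a ground state of the full Hamiltonian, where
`e(G) = E₀(H_G)`), `E ≤ (|B|/N) · e(G) + |∂_R B| · Σ_{δ ∈ R} K δ`. [cite: Ruelle1969, §2.3] -/
theorem le_of_forall_le_regionSum_translateRegion (hk0 : ∀ δ, δ ∉ R → ∀ x, k x (x + δ) = 0)
    (hK : ∀ δ ∈ R, ∀ x, |k x (x + δ)| ≤ K δ) {E : ℝ} (hE : ∀ v, E ≤ regionSum a k (translateRegion v B)) :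
    E ≤ (B.card : ℝ) / Fintype.card G * regionSum a k Finset.univ + (stepBoundary R B).card * ∑ δ ∈ R, K δ := by
  have hN : (0 : ℝ) < Fintype.card G := by
    have : 0 < Fintype.card G := Fintype.card_pos_iff.2 ⟨0⟩
    exact_mod_cast this
  have h1 : (Fintype.card G : ℝ) * E ≤ ∑ v, regionSum a k (translateRegion v B) := by
    calc (Fintype.card G : ℝ) * E = ∑ _v : G, E := by rw [Finset.sum_const, Finset.card_univ, nsmul_eq_mul]
      _ ≤ _ := Finset.sum_le_sum fun v _ => hE v
  have h2 := sum_regionSum_translateRegion_le a k B R K hk0 hK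
  have h3 : (Fintype.card G : ℝ) * E ≤
      Fintype.card G * ((B.card : ℝ) / Fintype.card G * regionSum a k Finset.univ +
        (stepBoundary R B).card * ∑ δ ∈ R, K δ) := by
    calc (Fintype.card G : ℝ) * E ≤ _ := h1.trans h2
      _ = _ := by field_simp
  exact le_of_mul_le_mul_left h3 hN

end Bound

end Literature.MathematicalPhysics.QuantumLattice
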